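import Summits.CriticalPhenomena.PercolationContinuityZ3.Theorems.PercNearOneGluingNoHeavyPcintKernNCZ4S8Defs
import HarnessLib

/-!
# PCINT lane, kernel check 32/32 of the B2c (`nawchain_cw`) window certificate `d = 4`, memory 8 (7-step windows, `kc = 4`): 3 prefix blocks, 192 rows

Cell `prim-pcint`, seat `prim-pcint-2` (gen 3).  Collatz–Wielandt rows `10^5 · row ≤ 99999 · DEN · v` on the normal forms extending
each listed 5-step prefix (`WinK.nfCodesP`, `…PcintWinKernelNFP`), by `decide +kernel` (`WinK.allB`; table values from the
search tree `WinK.KT.ofListF 13 tbl`, `…PcintWinKernelTree`; weights `WinK.termSc`, `…PcintWinKernelChainCert`; `maxHeartbeats 0`).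
Does NOT build on p205010.
-/

namespace Summit.CriticalPhenomena.PercolationContinuityZ3.Theorems.Pcint.NCZ4S8

set_option maxHeartbeats 0 in
/-- The 64 rows of the normal forms extending the prefix `[((0 : Fin 4), true), ((1 : Fin 4), true), ((2 : Fin 4), true), ((3 : Fin 4), true), ((2 : Fin 4), false)]` (scan state 4) hold. [folklore] -/
theorem leaf_254 : (WinK.nfCodesP 4 7 4 [((0 : Fin 4), true), ((1 : Fin 4), true), ((2 : Fin 4), true), ((3 : Fin 4), true), ((2 : Fin 4), false)]).all (WinK.rowOKScT 4 6 4 1687 9772 99999 52576 (WinK.KT.ofListF 13 tbl)) = true :=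
  WinK.all_of_allB (fuel := 12) (by decide +kernel)

set_option maxHeartbeats 0 in
/-- The 64 rows of the normal forms extending the prefix `[((0 : Fin 4), true), ((1 : Fin 4), true), ((2 : Fin 4), true), ((3 : Fin 4), true), ((3 : Fin 4), true)]` (scan state 4) hold. [folklore] -/
theorem leaf_255 : (WinK.nfCodesP 4 7 4 [((0 : Fin 4), true), ((1 : Fin 4), true), ((2 : Fin 4), true), ((3 : Fin 4), true), ((3 : Fin 4), true)]).all (WinK.rowOKScT 4 6 4 1687 9772 99999 52576 (WinK.KT.ofListF 13 tbl)) = true :=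
  WinK.all_of_allB (fuel := 12) (by decide +kernel)

set_option maxHeartbeats 0 in
/-- The 64 rows of the normal forms extending the prefix `[((0 : Fin 4), true), ((1 : Fin 4), true), ((2 : Fin 4), true), ((3 : Fin 4), true), ((3 : Fin 4), false)]` (scan state 4) hold. [folklore] -/
theorem leaf_256 : (WinK.nfCodesP 4 7 4 [((0 : Fin 4), true), ((1 : Fin 4), true), ((2 : Fin 4), true), ((3 : Fin 4), true), ((3 : Fin 4), false)]).all (WinK.rowOKScT 4 6 4 1687 9772 99999 52576 (WinK.KT.ofListF 13 tbl)) = true :=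
  WinK.all_of_allB (fuel := 12) (by decide +kernel)

end Summit.CriticalPhenomena.PercolationContinuityZ3.Theorems.Pcint.NCZ4S8
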